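import Literature.NumberTheory.Automorphic.JacquetLengthTwoLabels
import HarnessLib

/-!
# A representation with a constituent of smaller Jacquet rank is reducible

Generic representation theory (theorems only; no definition, no named fact, no instance), automorphic-free, over ★
`IrrClass.IsConstituentOf` (`Automorphic/IrreducibleClassesConstituents`: ★ `IsConstituentOf.nonempty_equiv_of_isIrreducible` — an
irreducible representation is its only constituent) and ★ `Representation.jacquetMap` (`Automorphic/JacquetModule`; ★
`IrrClass.jacquetMap_equiv_injective`).  For a parabolic triple `t = (P, M, N)` of `G` and a representation `ρ` with finite-dimensional
Jacquet module `r(ρ) = (t.restrict ρ).Coinvariants`: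

* `exists_subrepresentation_of_isConstituentOf_of_finrank_lt` — if some constituent `⟦r⟧` of `ρ` has `dim r(r) < dim r(ρ)`, then `ρ` has a
  `G`-stable subspace `⊥ ≠ N ≠ ⊤` (were `ρ` irreducible, `r ≅ ρ`, so the Jacquet modules would be isomorphic);
* `exists_subrepresentation_of_isConstituentOf_of_finrank_le_one` — the rank-one reading: a constituent with `dim r ≤ 1` inside a
  representation with `dim r = 2` (the principal series `i_G(χ)` of `U(3)`, ★ N1 `UnitaryGroup.U3PrincipalSeriesJacquetFiltration`) forces
  reducibility.  This is how [GelbartRogawski1991, §5.1–5.2] read the reducibility of `i_G(χ)` at the theta point off the Jacquet module of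
  the local theta type (`r_N(X_v) ≅ ℱ_v[ψθ]`, one-dimensional, [GelbartRogawski1991, §3.2]; [Kudla1986, Thm. 2.8]) — the alternative to
  Keys' `c`-function argument [Keys1984, §7] recorded in [Rogawski1990, §12.2 (2)].

Written for the T3 «KeysCaseTwo» line of cell pub/hodgecm-mathlib F0∕P3 (road T to node N4 of `F0/P3/T3b-TREE.md`).

## References
* [GelbartRogawski1991] S. Gelbart, J. Rogawski, *L-functions and Fourier–Jacobi coefficients for the unitary group U(3)*, Invent. Math.
  105 (1991), §3.2 p. 457, §5.1–5.2 pp. 465–467.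
* [Kudla1986] S. Kudla, *On the local theta-correspondence*, Invent. Math. 83 (1986), Thm. 2.8.
* [Rogawski1990] J. D. Rogawski, *Automorphic Representations of Unitary Groups in Three Variables*, §12.2 (2) pp. 173–174.
* [BushnellHenniart2006] C. Bushnell, G. Henniart, *The local Langlands conjecture for GL(2)*, §1.1, §2 (constituents).
-/

set_option autoImplicit false

noncomputable section

namespace Literature.NumberTheory.Automorphic

namespace IrrClass

universe u

variable {G : Type u} [Group G] [TopologicalSpace G] (t : ParabolicTriple G)

omit [TopologicalSpace G] in
/-- A representation whose Jacquet module along `t` is non-zero is itself non-zero. [folklore] -/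
private theorem nontrivial_of_finrank_coinvariants_pos {V : Type*} [AddCommGroup V] [Module ℂ V] (ρ : Representation ℂ G V)
    (h : 0 < Module.finrank ℂ (t.restrict ρ).Coinvariants) : Nontrivial V := by
  by_contra hV
  rw [not_nontrivial_iff_subsingleton] at hV
  haveI : Subsingleton (t.restrict ρ).Coinvariants := (Representation.Coinvariants.mk_surjective _).subsingleton
  have h0 : Module.finrank ℂ (t.restrict ρ).Coinvariants = 0 := Module.finrank_zero_of_subsingleton
  omega

/-- **A representation with a constituent of SMALLER JACQUET RANK is reducible.**  If `⟦r⟧` is a constituent of `ρ` (both Jacquet modules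
finite-dimensional) with `dim r(r) < dim r(ρ)`, then `ρ` has a `G`-stable subspace `N` with `N ≠ ⊥`, `N ≠ ⊤`: otherwise `ρ` is irreducible, its
only constituent is its own class (★ `IsConstituentOf.nonempty_equiv_of_isIrreducible`: `r ≅ ρ`), and equivalent representations have Jacquet
modules of the same dimension (★ `jacquetMap_equiv_injective` both ways). [cite: GelbartRogawski1991, §5.1 (5.1.1) p. 465; §5.2 p. 467]
[cite: BushnellHenniart2006, §1.1] -/
theorem exists_subrepresentation_of_isConstituentOf_of_finrank_lt {V : Type} [AddCommGroup V] [Module ℂ V]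
    {ρ : Representation ℂ G V} [FiniteDimensional ℂ (t.restrict ρ).Coinvariants]
    (r : SmoothIrrep G) (hc : (IrrClass.mk r).IsConstituentOf ρ) [FiniteDimensional ℂ (t.restrict r.ρ).Coinvariants]
    (hlt : Module.finrank ℂ (t.restrict r.ρ).Coinvariants < Module.finrank ℂ (t.restrict ρ).Coinvariants) :
    ∃ N : Subrepresentation ρ, N ≠ ⊥ ∧ N ≠ ⊤ := by
  by_contra h
  push Not at h
  -- `ρ ≠ 0` (its Jacquet module is non-zero), so `⊥ ≠ ⊤` among its subrepresentations
  haveI : Nontrivial V := nontrivial_of_finrank_coinvariants_pos t ρ (by omega)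
  haveI : Nontrivial (Subrepresentation ρ) := ⟨⟨⊥, ⊤, fun hbt => by
    have h' : ((⊥ : Subrepresentation ρ).toSubmodule : Submodule ℂ V) = (⊤ : Subrepresentation ρ).toSubmodule := by rw [hbt]
    exact bot_ne_top h'⟩⟩
  -- hence `ρ` is irreducible
  haveI : ρ.IsIrreducible := ⟨fun N => (eq_or_ne N ⊥).elim Or.inl fun hN => Or.inr (h N hN)⟩
  -- so `r ≅ ρ`, and the Jacquet ranks agree
  obtain ⟨e⟩ := hc.nonempty_equiv_of_isIrreducible
  have h₁ := LinearMap.finrank_le_finrank_of_injective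
    (f := (Representation.jacquetMap t e.toIntertwiningMap).toLinearMap) (jacquetMap_equiv_injective t e)
  have h₂ := LinearMap.finrank_le_finrank_of_injective
    (f := (Representation.jacquetMap t e.symm.toIntertwiningMap).toLinearMap) (jacquetMap_equiv_injective t e.symm)
  omega

/-- **Rank-one reading**: a constituent with AT MOST ONE-dimensional Jacquet module inside a representation with TWO-dimensional Jacquet
module forces reducibility (`i_G(χ)` of `U(3)` and the local theta type `X_v`, `r_N(X_v) ≅ ℱ_v[ψθ]`).
[cite: GelbartRogawski1991, §3.2 p. 457; §5.2 p. 467] [cite: Kudla1986, Thm. 2.8] [cite: Rogawski1990, §12.2 (2) p. 174] -/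
theorem exists_subrepresentation_of_isConstituentOf_of_finrank_le_one {V : Type} [AddCommGroup V] [Module ℂ V]
    {ρ : Representation ℂ G V} [FiniteDimensional ℂ (t.restrict ρ).Coinvariants]
    (h2 : Module.finrank ℂ (t.restrict ρ).Coinvariants = 2)
    (r : SmoothIrrep G) (hc : (IrrClass.mk r).IsConstituentOf ρ) [FiniteDimensional ℂ (t.restrict r.ρ).Coinvariants]
    (h1 : Module.finrank ℂ (t.restrict r.ρ).Coinvariants ≤ 1) :
    ∃ N : Subrepresentation ρ, N ≠ ⊥ ∧ N ≠ ⊤ :=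
  exists_subrepresentation_of_isConstituentOf_of_finrank_lt t r hc (by omega)

end IrrClass

end Literature.NumberTheory.Automorphic

end
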